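import Summits.AtomisticToContinuum.HydrodynamicLimit.Theorems.OneFlightGossipEngineCollisionActivityTailsAbnormalActivityTaggedStatics
import HarnessLib

/-!
# `CollisionActivityTails` (stmt-AtomisticToContinuum-13734), line `plaque-thinning-count-ld`, stub 5, TAGGED half — file 2/6:
the one-window tube functional of a pair and the count tag at one scale

Helper file (`--supports stmt-AtomisticToContinuum-13734`) of the crux
`Summit.AtomisticToContinuum.HydrodynamicLimit.Theses.OneFlightGossipEngine.CollisionActivityTails`, line `plaque-thinning-count-ld`,
stub 5 (abnormal activity), TAGGED half `stub_taggedFromLabelEnvelope : LabelEnvelopeFromEnvelope → TaggedFromEnvelope`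
(file `…AbnormalActivityTagged`): under the true local Gibbs law the tagged cold window activity (collisions of particles sitting in an
over-dense or over-heated ball at some scale `≥ K`) is small in mean, from a label-set law envelope of the laws at the times of the
window. Vocabulary: `Tagged`, `tagAct`, `TaggedSmallOn`, `TaggedFromEnvelope`, `imp_le_relSpeed` of `…AbnormalActivity(Hot)` (w-abnormal),
`LabelLawEnvelope`, `LabelEnvelopeOn`, `LabelEnvelopeFromEnvelope` of `…EnvelopePlumbing` (lead), `windowEvent`, `pairTubeSet` of
`…AbnormalActivityStatics`.

This file: §2 the one-window tube functional `tubePair S (w_k, w_l) = 𝟙{pair in the swept tube} |v_k - v_l|` of an ordered pair and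
its Gaussian pair integral `≤ 4ε²h ∫∫ |v-v'|² W` (`lintegral_tubePair_weight_le`: Haar section of the lifted tube
`volume_setOf_exists_reprSym_add_latticeVec_mem_le`, total Haar mass `1`); §3 the COUNT tag at one scale:
`𝟙{m'+2 ≤ #{j : |x_j-x_k| ≤ R}} ≤ Σ_{A ⊆ univ∖{k,l}, |A|=m'} Π_{j∈A} 𝟙{|x_j-x_k| ≤ R}` and
`∫ tubePair 𝟙{count} dμ ≤ binom(N-1,m') C² (C V_R c_β)^{m'} 4ε²h J` (`lintegral_tubePair_count_le`, registered helper sub-goal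
`stub_taggedCountScale`).

References: C. Cercignani, R. Illner, M. Pulvirenti, *The Mathematical Theory of Dilute Gases* (1994), §4.3, App. 4.A (collision
cylinders, collision sums along the hard-sphere flow); I. Gallagher, L. Saint-Raymond, B. Texier, *From Newton to Boltzmann* (2013),
Ch. 4. Elementary measure theory and bookkeeping; recorded here.
-/

noncomputable section

open MeasureTheory Set Filter Topology
open scoped ENNReal

namespace Summit.AtomisticToContinuum.HydrodynamicLimit.Theorems.CollisionActivityTailsAbnormalActivityTagged

open Literature.MathematicalPhysics.KineticTheory Literature.Analysis.FluidPDE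
open Summit.AtomisticToContinuum.HydrodynamicLimit.Theorems.CollisionActivityTailsActivityDomination
  (Flow Cfg window act tdist nearCount collisionPairSum_nonneg window_pos)
open Summit.AtomisticToContinuum.HydrodynamicLimit.Theorems.CollisionActivityTailsAbnormalActivityStatics
open Summit.AtomisticToContinuum.HydrodynamicLimit.Theorems.CollisionActivityTailsCrowdedActivityMeasurable
  (measurable_tdist_config natCast_nearCount)
open Summit.AtomisticToContinuum.HydrodynamicLimit.Theorems.CollisionActivityTailsEndpointTails (ae_mem_good_localGibbsLaw)
-- the tagging vocabulary and the two statements of the tagged half (w-abnormal's reduction file, landed):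
open Summit.AtomisticToContinuum.HydrodynamicLimit.Theorems.CollisionActivityTailsAbnormalActivity
  (rec imp relSpeed scaleRadius ballKinetic Tagged tagAct TaggedSmallOn TaggedFromEnvelope imp_le_relSpeed
    hsDiameter_sq_mul_window eventually_window_lt)
-- σ-finiteness of the phase spaces (named instances, landed):
open Summit.AtomisticToContinuum.HydrodynamicLimit.Theorems.MacroBookkeeping (sigmaFinite_volume_phase sigmaFinite_volume_config)
-- the label-set envelope vocabulary (the lead's plumbing, landed with `stub_labelEnvelopeOn`):
open Summit.AtomisticToContinuum.HydrodynamicLimit.Theorems.CollisionActivityTailsEnvelopePlumbing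
  (gaussTupleWeight LabelLawEnvelope LabelEnvelopeOn LabelEnvelopeFromEnvelope)

/-! ## §2 The one-window tube functional of a pair and its Gaussian pair integral -/

section TubePair

open Literature.Analysis.FunctionSpaces (Torus.latticeVec)

variable {N : ℕ}

/-- The ONE-WINDOW TUBE FUNCTIONAL of an ordered pair of phase points: `𝟙{(x - x', v, v') ∈ pairTubeSet S} · |v - v'|` — on
configurations, `𝟙_{windowEvent S k l}(w) |v_k - v_l| = tubePair S (w k) (w l)`. -/
def tubePair (S : V3 → Set V3) (p p' : T3 × V3) : ℝ≥0∞ :=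
  (pairTubeSet S).indicator (fun _ => ENNReal.ofReal ‖p.2 - p'.2‖) (p.1 - p'.1, p.2, p'.2)

/-- The tube functional is at most the relative speed. -/
theorem tubePair_le (S : V3 → Set V3) (p p' : T3 × V3) : tubePair S p p' ≤ ENNReal.ofReal ‖p.2 - p'.2‖ :=
  indicator_le_self _ _ _

/-- The tube functional is jointly measurable (jointly measurable tube family). -/
theorem measurable_tubePair {S : V3 → Set V3} (hSm : MeasurableSet {q : V3 × V3 | q.1 ∈ S q.2}) :
    Measurable fun pp : (T3 × V3) × (T3 × V3) => tubePair S pp.1 pp.2 := by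
  unfold tubePair
  have hc : Measurable fun pp : (T3 × V3) × (T3 × V3) => (pp.1.1 - pp.2.1, pp.1.2, pp.2.2) :=
    (measurable_fst.fst.sub measurable_snd.fst).prodMk (measurable_fst.snd.prodMk measurable_snd.snd)
  have hn : Measurable fun pp : (T3 × V3) × (T3 × V3) => ENNReal.ofReal ‖pp.1.2 - pp.2.2‖ :=
    (measurable_fst.snd.sub measurable_snd.snd).norm.ennreal_ofReal
  exact Measurable.ite ((measurableSet_pairTubeSet hSm).preimage hc) hn measurable_const

/-- On configurations: the indicator of the window event times the relative speed is the tube functional of `(w k, w l)`. -/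
theorem indicator_windowEvent_eq_tubePair (S : V3 → Set V3) (k l : Fin (N + 1)) (w : Cfg N) (F : Cfg N → ℝ≥0∞) :
    (windowEvent S k l).indicator (fun w => ENNReal.ofReal ‖(w k).2 - (w l).2‖ * F w) w = tubePair S (w k) (w l) * F w := by
  unfold tubePair
  by_cases hw : w ∈ windowEvent S k l
  · rw [indicator_of_mem hw, indicator_of_mem (show ((w k).1 - (w l).1, (w k).2, (w l).2) ∈ pairTubeSet S from hw)]
  · rw [indicator_of_notMem hw, indicator_of_notMem (show ((w k).1 - (w l).1, (w k).2, (w l).2) ∉ pairTubeSet S from hw),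
      zero_mul]

/-- Haar section of the lifted tube: for fixed `x'`, `v`, `v'`, the set of `x` with `(x - x', v, v')` in the pair set has Haar
measure `≤ vol (S (v' - v))` (`volume_setOf_exists_reprSym_add_latticeVec_mem_le`: the minimal-image lift costs nothing). -/
theorem volume_section_pairTubeSet_le {S : V3 → Set V3} (hSm : MeasurableSet {q : V3 × V3 | q.1 ∈ S q.2}) (x' : T3) (v v' : V3) :
    volume {x : T3 | (x - x', v, v') ∈ pairTubeSet S} ≤ volume (S (v' - v)) := by
  have hSu : MeasurableSet (S (v' - v)) := hSm.preimage (measurable_id.prodMk measurable_const)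
  exact volume_setOf_exists_reprSym_add_latticeVec_mem_le x' hSu

/-- **The Gaussian pair integral of the tube functional**: for a tube family of volume `≤ 4 ε² h |u|` and a measurable velocity
weight `W`, `∫∫ tubePair S p p' · W(v, v') e^{-β|v|²/2} e^{-β|v'|²/2} dp dp' ≤ 4 ε² h ∫∫ |v - v'|² W(v, v') e^{-β|v|²/2} e^{-β|v'|²/2} dv dv'`
(Tonelli: the Haar section of the lifted tube in `x`, then the total Haar mass `1` in `x'`). -/
theorem lintegral_tubePair_weight_le {S : V3 → Set V3} (hSm : MeasurableSet {q : V3 × V3 | q.1 ∈ S q.2}) {ε h : ℝ}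
    (hεh : 0 ≤ 4 * ε ^ 2 * h) (hSvol : ∀ u, volume (S u) ≤ ENNReal.ofReal (4 * ε ^ 2 * h * ‖u‖)) (β : ℝ)
    {W : V3 → V3 → ℝ≥0∞} (hW : Measurable fun vv : V3 × V3 => W vv.1 vv.2) :
    ∫⁻ pp : (T3 × V3) × (T3 × V3), tubePair S pp.1 pp.2 * W pp.1.2 pp.2.2 * gaussWeight β pp.1 * gaussWeight β pp.2 ≤
      ENNReal.ofReal (4 * ε ^ 2 * h) *
        ∫⁻ vv : V3 × V3, ENNReal.ofReal (‖vv.1 - vv.2‖ ^ 2) * W vv.1 vv.2 * gaussV β vv.1 * gaussV β vv.2 := by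
  set F : (T3 × V3) × (T3 × V3) → ℝ≥0∞ := fun pp =>
    tubePair S pp.1 pp.2 * W pp.1.2 pp.2.2 * gaussWeight β pp.1 * gaussWeight β pp.2 with hF
  have hFm : Measurable F := (((measurable_tubePair hSm).mul (hW.comp (measurable_fst.snd.prodMk measurable_snd.snd))).mul
    ((measurable_gaussWeight β).comp measurable_fst)).mul ((measurable_gaussWeight β).comp measurable_snd)
  set H : V3 → V3 → ℝ≥0∞ := fun v v' =>
    ENNReal.ofReal (4 * ε ^ 2 * h) * (ENNReal.ofReal (‖v - v'‖ ^ 2) * W v v' * gaussV β v * gaussV β v') with hH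
  have hHm : Measurable fun vv : V3 × V3 => H vv.1 vv.2 := by
    refine Measurable.const_mul ?_ _
    exact ((((measurable_fst.sub measurable_snd).norm.pow_const 2).ennreal_ofReal.mul hW).mul
      ((measurable_gaussV β).comp measurable_fst)).mul ((measurable_gaussV β).comp measurable_snd)
  -- the section bound, for fixed `p' = (x', v')` and `v`
  have hsec : ∀ (p' : T3 × V3) (v : V3), ∫⁻ x : T3, F ((x, v), p') ≤ H v p'.2 := by
    intro p' v
    have hind : ∀ x : T3, F ((x, v), p') =
        {x : T3 | (x - p'.1, v, p'.2) ∈ pairTubeSet S}.indicator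
          (fun _ => ENNReal.ofReal ‖v - p'.2‖ * W v p'.2 * gaussV β v * gaussV β p'.2) x := by
      intro x
      simp only [hF, tubePair, gaussWeight_eq]
      by_cases hx : (x - p'.1, v, p'.2) ∈ pairTubeSet S
      · rw [indicator_of_mem hx, indicator_of_mem (show x ∈ {x : T3 | (x - p'.1, v, p'.2) ∈ pairTubeSet S} from hx)]
      · rw [indicator_of_notMem hx, indicator_of_notMem (show x ∉ {x : T3 | (x - p'.1, v, p'.2) ∈ pairTubeSet S} from hx)]
        simp
    have hsm : MeasurableSet {x : T3 | (x - p'.1, v, p'.2) ∈ pairTubeSet S} :=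
      (measurableSet_pairTubeSet hSm).preimage ((measurable_id.sub measurable_const).prodMk measurable_const)
    simp_rw [hind]
    rw [lintegral_indicator_const hsm]
    calc ENNReal.ofReal ‖v - p'.2‖ * W v p'.2 * gaussV β v * gaussV β p'.2 * volume {x : T3 | (x - p'.1, v, p'.2) ∈ pairTubeSet S}
        ≤ ENNReal.ofReal ‖v - p'.2‖ * W v p'.2 * gaussV β v * gaussV β p'.2 * ENNReal.ofReal (4 * ε ^ 2 * h * ‖p'.2 - v‖) := by
          gcongr; exact (volume_section_pairTubeSet_le hSm p'.1 v p'.2).trans (hSvol _)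
      _ = H v p'.2 := by
          simp only [hH]
          rw [norm_sub_rev p'.2 v, ENNReal.ofReal_mul hεh, pow_two ‖v - p'.2‖, ENNReal.ofReal_mul (norm_nonneg _)]
          ring
  -- Tonelli
  have hvol : (volume : Measure ((T3 × V3) × (T3 × V3))) = (volume : Measure (T3 × V3)).prod volume := rfl
  have hvol1 : (volume : Measure (T3 × V3)) = (volume : Measure T3).prod volume := rfl
  have hvol2 : (volume : Measure (V3 × V3)) = (volume : Measure V3).prod volume := rfl
  calc ∫⁻ pp, F pp = ∫⁻ p' : T3 × V3, ∫⁻ p : T3 × V3, F (p, p') := by rw [hvol, lintegral_prod_symm _ hFm.aemeasurable]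
    _ = ∫⁻ p' : T3 × V3, ∫⁻ v : V3, ∫⁻ x : T3, F ((x, v), p') := by
        refine lintegral_congr fun p' => ?_
        have hm1 : Measurable fun p : T3 × V3 => F (p, p') := hFm.comp (measurable_id.prodMk measurable_const)
        rw [hvol1, lintegral_prod_symm _ hm1.aemeasurable]
    _ ≤ ∫⁻ p' : T3 × V3, ∫⁻ v : V3, H v p'.2 := lintegral_mono fun p' => lintegral_mono fun v => hsec p' v
    _ = ∫⁻ v' : V3, ∫⁻ v : V3, H v v' := by
        have hm : Measurable fun v' : V3 => ∫⁻ v : V3, H v v' := hHm.lintegral_prod_left'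
        have hm2 : Measurable fun q : T3 × V3 => ∫⁻ v : V3, H v q.2 := hm.comp measurable_snd
        rw [hvol1, lintegral_prod _ hm2.aemeasurable]
        simp only [lintegral_const, measure_univ, mul_one]
    _ = ∫⁻ vv : V3 × V3, H vv.1 vv.2 := by rw [hvol2, lintegral_prod_symm _ hHm.aemeasurable]
    _ = _ := by rw [hH, lintegral_const_mul' _ _ ENNReal.ofReal_ne_top]

/-- The pair integral of the tube functional against the Gaussian weights is `≤ 4ε²h · J(β)` (weight `1 ≤ e^{λ|v|²} e^{λ|v'|²}`). -/
theorem lintegral_tubePair_gauss_le {S : V3 → Set V3} (hSm : MeasurableSet {q : V3 × V3 | q.1 ∈ S q.2}) {ε h : ℝ}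
    (hεh : 0 ≤ 4 * ε ^ 2 * h) (hSvol : ∀ u, volume (S u) ≤ ENNReal.ofReal (4 * ε ^ 2 * h * ‖u‖)) {β : ℝ} (hβ : 0 ≤ β) :
    ∫⁻ pp : (T3 × V3) × (T3 × V3), tubePair S pp.1 pp.2 * gaussWeight β pp.1 * gaussWeight β pp.2 ≤
      ENNReal.ofReal (4 * ε ^ 2 * h) * fluxJ β := by
  have h := lintegral_tubePair_weight_le hSm hεh hSvol β (W := fun _ _ => 1) measurable_const
  simp only [mul_one] at h
  refine h.trans ?_
  unfold fluxJ
  refine mul_le_mul' le_rfl (lintegral_mono fun vv => ?_)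
  have h1 : (1 : ℝ≥0∞) ≤ expW β vv.1 * expW β vv.2 := by
    calc (1 : ℝ≥0∞) = 1 * 1 := (mul_one 1).symm
      _ ≤ _ := mul_le_mul' (one_le_expW hβ _) (one_le_expW hβ _)
  calc ENNReal.ofReal (‖vv.1 - vv.2‖ ^ 2) * gaussV β vv.1 * gaussV β vv.2
      = ENNReal.ofReal (‖vv.1 - vv.2‖ ^ 2) * 1 * gaussV β vv.1 * gaussV β vv.2 := by rw [mul_one]
    _ ≤ _ := by gcongr

/-- The pair integral of the tube functional with the exponential velocity weights is `≤ 4ε²h · J(β)` (definition of `J`). -/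
theorem lintegral_tubePair_expW_le {S : V3 → Set V3} (hSm : MeasurableSet {q : V3 × V3 | q.1 ∈ S q.2}) {ε h : ℝ}
    (hεh : 0 ≤ 4 * ε ^ 2 * h) (hSvol : ∀ u, volume (S u) ≤ ENNReal.ofReal (4 * ε ^ 2 * h * ‖u‖)) (β : ℝ) :
    ∫⁻ pp : (T3 × V3) × (T3 × V3), tubePair S pp.1 pp.2 * (expW β pp.1.2 * expW β pp.2.2) * gaussWeight β pp.1 *
        gaussWeight β pp.2 ≤ ENNReal.ofReal (4 * ε ^ 2 * h) * fluxJ β :=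
  lintegral_tubePair_weight_le hSm hεh hSvol β (W := fun v v' => expW β v * expW β v')
    (((measurable_expW β).comp measurable_fst).mul ((measurable_expW β).comp measurable_snd))

/-- The tube functional of `(w k, w l)` is a measurable function of the configuration. -/
theorem measurable_tubePair_cfg {S : V3 → Set V3} (hSm : MeasurableSet {q : V3 × V3 | q.1 ∈ S q.2}) (k l : Fin (N + 1)) :
    Measurable fun w : Cfg N => tubePair S (w k) (w l) :=
  (measurable_tubePair hSm).comp (f := fun w : Cfg N => (w k, w l)) ((measurable_pi_apply k).prodMk (measurable_pi_apply l))

/-- The ball indicator of `(x_k, x_j)` is a measurable function of the configuration. -/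
theorem measurable_nearInd_cfg (R : ℝ) (k j : Fin (N + 1)) : Measurable fun w : Cfg N => nearInd R (w k).1 (w j).1 :=
  (measurable_nearInd R).comp (f := fun w : Cfg N => ((w k).1, (w j).1))
    ((measurable_pi_apply k).fst.prodMk (measurable_pi_apply j).fst)

/-- The labels other than the pair number `N - 1`. -/
theorem card_univ_sdiff_pair {k l : Fin (N + 1)} (hkl : k ≠ l) : (Finset.univ \ {k, l} : Finset (Fin (N + 1))).card = N - 1 := by
  rw [Finset.card_univ_sdiff, Fintype.card_fin, Finset.card_pair hkl]
  omega

end TubePair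

/-! ## §3 The count tag at one scale -/

section CountTag

variable {N : ℕ}

/-- **Combinatorics of the count tag**: if at least `m' + 2` centres lie within `R` of `x_k`, some `m'`-subset `A` of the labels other
than `k, l` has all its centres within `R` of `x_k`:
`𝟙{m'+2 ≤ #{j : |x_j - x_k| ≤ R}} ≤ Σ_{A ⊆ univ∖{k,l}, |A| = m'} Π_{j∈A} 𝟙{|x_j - x_k| ≤ R}`. -/
theorem countInd_le_sum_prod (k l : Fin (N + 1)) (R : ℝ) (m' : ℕ) (w : Cfg N) :
    (if m' + 2 ≤ nearCount w k R then (1 : ℝ≥0∞) else 0) ≤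
      ∑ A ∈ (Finset.univ \ {k, l}).powersetCard m', ∏ j ∈ A, nearInd R (w k).1 (w j).1 := by
  split_ifs with hm
  · unfold nearCount at hm
    set F0 : Finset (Fin (N + 1)) := Finset.univ.filter fun j => tdist (w j).1 (w k).1 ≤ R with hF0
    have hF' : m' ≤ (F0 \ {k, l}).card := by
      have h1 : F0.card - ({k, l} : Finset (Fin (N + 1))).card ≤ (F0 \ {k, l}).card := Finset.le_card_sdiff _ _
      have h2 : ({k, l} : Finset (Fin (N + 1))).card ≤ 2 := Finset.card_le_two
      omega
    obtain ⟨A, hAF, hAcard⟩ := Finset.exists_subset_card_eq hF'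
    have hA : A ∈ (Finset.univ \ {k, l}).powersetCard m' := by
      rw [Finset.mem_powersetCard]
      exact ⟨hAF.trans (Finset.sdiff_subset_sdiff (Finset.subset_univ _) le_rfl), hAcard⟩
    have hone : ∏ j ∈ A, nearInd R (w k).1 (w j).1 = 1 := by
      refine Finset.prod_eq_one fun j hj => ?_
      have hj' : j ∈ F0 := (Finset.mem_sdiff.1 (hAF hj)).1
      rw [hF0, Finset.mem_filter] at hj'
      simp [nearInd, hj'.2]
    calc (1 : ℝ≥0∞) = ∏ j ∈ A, nearInd R (w k).1 (w j).1 := hone.symm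
      _ ≤ ∑ A ∈ (Finset.univ \ {k, l}).powersetCard m', ∏ j ∈ A, nearInd R (w k).1 (w j).1 :=
          Finset.single_le_sum (f := fun A => ∏ j ∈ A, nearInd R (w k).1 (w j).1) (fun _ _ => bot_le) hA
  · exact bot_le

/-- **COUNT TAG AT ONE SCALE under a label-set envelope**: with `V = (4π/3)R³`, `c_β = (2π/β)^{3/2}`, `J = fluxJ β`,
`∫ tubePair(w_k,w_l) 𝟙{m'+2 ≤ #{j : |x_j-x_k| ≤ R}} dμ ≤ binom(N-1, m') · C² (C V c_β)^{m'} · 4ε²h J`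
(union over the `m'`-clusters, the key cluster bound per cluster, the pair integral of the tube). -/
theorem lintegral_tubePair_count_le {μ : Measure (Cfg N)} {C β : ℝ} (hC : 0 ≤ C) (hβ : 0 < β) (hμ : LabelLawEnvelope μ C β)
    {k l : Fin (N + 1)} (hkl : k ≠ l) {S : V3 → Set V3} (hSm : MeasurableSet {q : V3 × V3 | q.1 ∈ S q.2}) {ε h : ℝ}
    (hεh : 0 ≤ 4 * ε ^ 2 * h) (hSvol : ∀ u, volume (S u) ≤ ENNReal.ofReal (4 * ε ^ 2 * h * ‖u‖)) (R : ℝ) (m' : ℕ) :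
    ∫⁻ w, tubePair S (w k) (w l) * (if m' + 2 ≤ nearCount w k R then 1 else 0) ∂μ ≤
      ((N - 1).choose m' : ℝ≥0∞) * (ENNReal.ofReal (C ^ 2) *
        (ENNReal.ofReal C * (ballVol R * ENNReal.ofReal ((2 * Real.pi / β) ^ (3 / 2 : ℝ)))) ^ m' *
          (ENNReal.ofReal (4 * ε ^ 2 * h) * fluxJ β)) := by
  set rest : Finset (Fin (N + 1)) := Finset.univ \ {k, l} with hrest
  set Φb : ℝ≥0∞ := ballVol R * ENNReal.ofReal ((2 * Real.pi / β) ^ (3 / 2 : ℝ)) with hΦb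
  set P : ℝ≥0∞ := ENNReal.ofReal (4 * ε ^ 2 * h) * fluxJ β with hP
  -- each cluster term
  have hterm : ∀ A ∈ rest.powersetCard m', ∫⁻ w, tubePair S (w k) (w l) * ∏ j ∈ A, nearInd R (w k).1 (w j).1 ∂μ ≤
      ENNReal.ofReal (C ^ 2) * (ENNReal.ofReal C * Φb) ^ m' * P := by
    intro A hA
    rw [Finset.mem_powersetCard] at hA
    have hAk : k ∉ A := fun h => by simpa [hrest] using hA.1 h
    have hAl : l ∉ A := fun h => by simpa [hrest] using hA.1 h
    have hφb : ∀ p : T3 × V3, ∫⁻ q, nearInd R p.1 q.1 * gaussWeight β q ≤ Φb := by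
      intro p
      calc ∫⁻ q, nearInd R p.1 q.1 * gaussWeight β q = ∫⁻ q : T3 × V3, nearInd R p.1 q.1 * gaussV β q.2 := rfl
        _ ≤ ballVol R * ∫⁻ v, gaussV β v := lintegral_nearInd_mul_le R p.1 (measurable_gaussV β)
        _ = Φb := by rw [hΦb, lintegral_gaussV hβ]
    have hkey := lintegral_pair_mul_prod_le hC hμ hkl hAk hAl (T := tubePair S) (φ := fun p q => nearInd R p.1 q.1)
      (measurable_tubePair hSm)
      ((measurable_nearInd R).comp (f := fun pp : (T3 × V3) × (T3 × V3) => (pp.1.1, pp.2.1))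
        (measurable_fst.fst.prodMk measurable_snd.fst)) hφb
    rw [hA.2] at hkey
    refine hkey.trans ?_
    gcongr
    exact lintegral_tubePair_gauss_le hSm hεh hSvol hβ.le
  have hrc : (rest.powersetCard m').card = (N - 1).choose m' := by
    rw [Finset.card_powersetCard, hrest, card_univ_sdiff_pair hkl]
  calc ∫⁻ w, tubePair S (w k) (w l) * (if m' + 2 ≤ nearCount w k R then 1 else 0) ∂μ
      ≤ ∫⁻ w, ∑ A ∈ rest.powersetCard m', tubePair S (w k) (w l) * ∏ j ∈ A, nearInd R (w k).1 (w j).1 ∂μ := by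
        refine lintegral_mono fun w => ?_
        rw [← Finset.mul_sum]
        exact mul_le_mul' le_rfl (countInd_le_sum_prod k l R m' w)
    _ = ∑ A ∈ rest.powersetCard m', ∫⁻ w, tubePair S (w k) (w l) * ∏ j ∈ A, nearInd R (w k).1 (w j).1 ∂μ := by
        have hAm : ∀ A : Finset (Fin (N + 1)), Measurable fun w : Cfg N =>
            tubePair S (w k) (w l) * ∏ j ∈ A, nearInd R (w k).1 (w j).1 := fun A =>
          (measurable_tubePair_cfg hSm k l).mul (Finset.measurable_prod _ fun j _ => measurable_nearInd_cfg R k j)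
        exact lintegral_finsetSum _ fun A _ => hAm A
    _ ≤ ∑ _A ∈ rest.powersetCard m', ENNReal.ofReal (C ^ 2) * (ENNReal.ofReal C * Φb) ^ m' * P := Finset.sum_le_sum hterm
    _ = _ := by rw [Finset.sum_const, hrc, nsmul_eq_mul]

/-- **Helper sub-goal `stub_taggedCountScale`** (line `plaque-thinning-count-ld`, stub 5, tagged half, file 2): the count tag at
one scale under a label-set law envelope (`lintegral_tubePair_count_le`, closed form). -/
theorem stub_taggedCountScale : ∀ {N : ℕ} {μ : Measure (Cfg N)} {C β : ℝ}, 0 ≤ C → 0 < β → LabelLawEnvelope μ C β → ∀ {k l : Fin (N + 1)}, k ≠ l → ∀ {S : V3 → Set V3}, MeasurableSet {q : V3 × V3 | q.1 ∈ S q.2} → ∀ {ε h : ℝ}, 0 ≤ 4 * ε ^ 2 * h → (∀ u, volume (S u) ≤ ENNReal.ofReal (4 * ε ^ 2 * h * ‖u‖)) → ∀ (R : ℝ) (m' : ℕ), ∫⁻ w, tubePair S (w k) (w l) * (if m' + 2 ≤ nearCount w k R then 1 else 0) ∂μ ≤ ((N - 1).choose m' : ℝ≥0∞) * (ENNReal.ofReal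 (C ^ 2) * (ENNReal.ofReal C * (ballVol R * ENNReal.ofReal ((2 * Real.pi / β) ^ (3 / 2 : ℝ)))) ^ m' * (ENNReal.ofReal (4 * ε ^ 2 * h) * fluxJ β)) :=
  fun hC hβ hμ _ _ hkl _ hSm _ _ hεh hSvol R m' => lintegral_tubePair_count_le hC hβ hμ hkl hSm hεh hSvol R m'

end CountTag

end Summit.AtomisticToContinuum.HydrodynamicLimit.Theorems.CollisionActivityTailsAbnormalActivityTagged

end
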